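import Summits.BirchSwinnertonDyer.BirchSwinnertonDyer.Theses.ShaPrimaryTransfer
import Literature.NumberTheory.EllipticCurves.KubertTateM919GaussianTwist
import HarnessLib

/-!
# BirchSwinnertonDyer / ShaPrimaryTransfer — crux `FiniteShaComponentTransfer` (stmt-BirchSwinnertonDyer-22356):
# A RANK-1 DOOR AT 5 BY THE CLASS-WIDE GAUSSIAN CRITERION — the twist `E_{-91/9}^{(-4)} = [0, −13276, 0, 5896800, −869306256]`

Helper file of prover seat `bsd-line-spt-p1` g21 (`--supports stmt-22356 --as helper`). THEOREMS ONLY. Third row of the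
Gaussian-twist table and the first obtained WITHOUT a `ℤ[i]`-valuation table: the tree's class-wide criterion
`KubertTateGaussianTwist.twist_door_of_le_rank` (Gaussian-tame `E_{m,n}`, full `ℚ`-box, `rank E^{(-4)}(ℚ) ≥ ω₁(mn)`) fed with
ONE rational point of infinite order on the twist (`KubertTateM919GaussianTwist`: `P = (48061, 8979477)`, `3 ∣ den x(2P)`;
torsion trivial since `#W̃(𝔽₅) = 5`, `#W̃(𝔽₁₁) = 14`).  Unconditionally: **`rank E_{-91/9}^{(-4)}(ℚ) = 1`, `t₅ = 0`** on a
curve with NO rational torsion; read in the route's currency: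

* `shaCorank_five_twist_eq_zero`, `mordellWeilRank_twist_eq_one`, `torsionOrder_twist_eq_one`;
* `oneFiniteShaComponent_twist` — O for the twist with witness `p₀ = 5`;
* `transfer_twist` — **T BY NAME** on the twist; `transfer_iff_twist` — T's content here is «`t_q = 0` for all `q`».

T is UNCHANGED (conjecture-grade at analytic rank ≥ 2) and BSD is NOT proved by any of this.

## References

* [SilvermanAEC2009] J. H. Silverman, *AEC*, 2nd ed., VII.3.4, Thm. X.4.2, Exercise 10.16.
* [Fisher2001FiveSevenDescent] T. Fisher, JEMS 3 (2001), §§1–2.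
-/

-- D-0017: single-problem summit, so `Summit.BirchSwinnertonDyer.BirchSwinnertonDyer.…` repeats a namespace BY DESIGN.
set_option linter.dupNamespace false
set_option autoImplicit false

noncomputable section

open scoped Classical
open Literature.NumberTheory.EllipticCurves WeierstrassCurve
open Summit.BirchSwinnertonDyer.BirchSwinnertonDyer.Theses.ShaPrimaryTransfer

namespace Summit.BirchSwinnertonDyer.BirchSwinnertonDyer.Theorems.ShaPrimaryTransferGaussianTwistDoorM919

/-- **`t₅(E_{-91/9}^{(-4)}/ℚ) = 0`, unconditionally** (class-wide Gaussian criterion; tree `KubertTateM919GaussianTwist.twist_M91_9`).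
[cite: SilvermanAEC2009, Thm. X.4.2 and Exercise 10.16] [cite: Fisher2001FiveSevenDescent, §2] -/
theorem shaCorank_five_twist_eq_zero :
    haveI := KubertTateM919GaussianTwist.isElliptic_twist
    ((kubertTateFive (((-91 : ℤ) : ℚ)) (((9 : ℤ) : ℚ))).quadraticTwist (-4)).shaCorank 5 = 0 :=
  KubertTateM919GaussianTwist.twist_M91_9.2.1

/-- **`rank E_{-91/9}^{(-4)}(ℚ) = 1`, unconditionally** (upper bound by descent over `ℚ(i)`, lower bound by the point
`(48061, 8979477)` of infinite order). [cite: SilvermanAEC2009, VII.3.4 and Exercise 10.16] -/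
theorem mordellWeilRank_twist_eq_one :
    haveI := KubertTateM919GaussianTwist.isElliptic_twist
    ((kubertTateFive (((-91 : ℤ) : ℚ)) (((9 : ℤ) : ℚ))).quadraticTwist (-4)).mordellWeilRank = 1 :=
  KubertTateM919GaussianTwist.twist_M91_9.1

/-- **`E_{-91/9}^{(-4)}(ℚ)_tors = 0`** — this door at `5` sits on a curve with no rational torsion whatsoever.
[cite: SilvermanAEC2009, VII.3.1] -/
theorem torsionOrder_twist_eq_one :
    haveI := KubertTateM919GaussianTwist.isElliptic_twist
    ((kubertTateFive (((-91 : ℤ) : ℚ)) (((9 : ℤ) : ℚ))).quadraticTwist (-4)).torsionOrder = 1 :=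
  KubertTateM919GaussianTwist.torsionOrder_twist_eq_one

/-- **O for `E_{-91/9}^{(-4)}` with witness `p₀ = 5`** (the route's `OneFiniteShaComponent` shape, unconditional).
[cite: SilvermanAEC2009, Thm. X.4.2] -/
theorem oneFiniteShaComponent_twist :
    haveI := KubertTateM919GaussianTwist.isElliptic_twist
    ∃ (p : ℕ) (_ : Fact p.Prime), ((kubertTateFive (((-91 : ℤ) : ℚ)) (((9 : ℤ) : ℚ))).quadraticTwist (-4)).shaCorank p = 0 :=
  ⟨5, ⟨Nat.prime_five⟩, shaCorank_five_twist_eq_zero⟩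

/-- **T BY NAME on `E_{-91/9}^{(-4)}`**: granting `FiniteShaComponentTransfer`, every primary component of `Ш(E_{-91/9}^{(-4)}/ℚ)`
has corank `0` (rank `1`; door `5`; no rational torsion). T itself is NOT proved. [cite: SilvermanAEC2009, Thm. X.4.2] -/
theorem transfer_twist (hT : FiniteShaComponentTransfer) (q : ℕ) [Fact q.Prime] :
    haveI := KubertTateM919GaussianTwist.isElliptic_twist
    ((kubertTateFive (((-91 : ℤ) : ℚ)) (((9 : ℤ) : ℚ))).quadraticTwist (-4)).shaCorank q = 0 := by
  haveI := KubertTateM919GaussianTwist.isElliptic_twist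
  haveI : Fact (Nat.Prime 5) := ⟨Nat.prime_five⟩
  exact hT _ 5 q shaCorank_five_twist_eq_zero

/-- **What T says about this curve, exactly**: the instance of T at `E_{-91/9}^{(-4)}` is EQUIVALENT to «`t_q = 0` for every
prime `q`» — the remaining content is the transfer `5 → q`, `q ≠ 5` (open). [cite: SilvermanAEC2009, Thm. X.4.2] -/
theorem transfer_iff_twist :
    haveI := KubertTateM919GaussianTwist.isElliptic_twist
    (∀ (p q : ℕ) [Fact p.Prime] [Fact q.Prime],
        ((kubertTateFive (((-91 : ℤ) : ℚ)) (((9 : ℤ) : ℚ))).quadraticTwist (-4)).shaCorank p = 0 →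
          ((kubertTateFive (((-91 : ℤ) : ℚ)) (((9 : ℤ) : ℚ))).quadraticTwist (-4)).shaCorank q = 0) ↔
      ∀ (q : ℕ) [Fact q.Prime], ((kubertTateFive (((-91 : ℤ) : ℚ)) (((9 : ℤ) : ℚ))).quadraticTwist (-4)).shaCorank q = 0 := by
  haveI := KubertTateM919GaussianTwist.isElliptic_twist
  haveI : Fact (Nat.Prime 5) := ⟨Nat.prime_five⟩
  constructor
  · intro h q _
    exact h 5 q shaCorank_five_twist_eq_zero
  · intro h p q _ _ _
    exact h q

end Summit.BirchSwinnertonDyer.BirchSwinnertonDyer.Theorems.ShaPrimaryTransferGaussianTwistDoorM919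

end
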